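import Summits.QuantumFields.BalabanUV.Beta.GAN24.StepCovarianceInputs
import Summits.QuantumFields.BalabanUV.Beta.GAN24.InverseRate

/-!
# G-an2-4 ∕ (CONV-C), route R7, letter ledger item (L3)-Γ_u — PART 2 (THE ENDS): BAŁABAN's STEP COVARIANCES `C^{(n)} = C(C*Δ_nC)⁻¹C*`
# ([B6] (2.156)) AT `U = 1` HAVE BOTH (CONV-C) CLAUSES IN KERNEL CURRENCY ON EVERY UNIT TORUS, FOR ANY TWO LEVELS, AT KING'S RATE `n⁻²`
# (θ = L⁻² ALONG `n_k = L^k`), AND THE NAMED FULL-SEQUENCE `η → 0` LIMIT — UNCONDITIONAL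

G-an2-4 formalisation swarm `b2b-balaban-gan24-formalise-*`, leaf prover 06 (gen 39), CRUX TEAM (2), ruling «YM REDIRECT» (e34b3e0c; FREEZE (0)
honoured; INTENT «STEP-COVARIANCE-TWO-CLAUSES», HOME/CLAIMS.log 2026-08-21 l.33123).  ROUTES-GAN24 v11 §2 R7 (y) listed the torus-currency unit
letter as «(L3) … Γ_u = C^{(k)}(1) = (C*Δ^{(k)}C)⁻¹ on the axial slice: ⇐ Δ_K's law ✓ + uniform invertibility on the slice … — ○ S» (rider of record,
refuter #27: «S GIVEN sliced coercivity»; v14 (kk) unchanged).  THIS FILE types it, every input BY NAME, for pv09's object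
`(bondReductionT L M (reDelK n hn M)).cov` = Bałaban's `C^{(k)} = C(C*Δ_kC)⁻¹C*` with the genuine (1.65) `Δ_k` at fine spacing `n⁻¹` and the
explicit axial-gauge elimination `C` of p. 250 (entrywise; no new definition):
 * **`stepCov_two_levels`** — `d + 1 ≥ 2`, `L ≥ 1` ⟹ `∃ κ C > 0` (functions of `d, L`) such that on EVERY unit torus `M` with `L ∣ M_i`, for ANY
   two levels `1 ≤ n ≤ m` and all bond variables `b, b′`: (i) `|C^{(n)}(b,b′)| ≤ C·e^{−κρ_M(b₋,b′₋)}`; (ii) `|C^{(m)}(b,b′) − C^{(n)}(b,b′)| ≤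
   C·n⁻²·e^{−κρ_M(b₋,b′₋)}` — PART 1's socket `sandwichCov_two_levels_of_inputs` with its inputs DISCHARGED for the genuine `Δ_k` by pv09
   (`reDelK_isSymm`, `kernelDecay_reDelK`, and THE SLICED COERCIVITY (2.153) `lowerOnConstrainedT_reDelK` at `gamma2153 (d+1) L`, n-FREE — the #27
   rider is a tree theorem) and the difference letter `ε = C_Δ·n⁻²` by PART 1's `abs_reDelK_sub_le` (NE2's (1.66) strip rate, every torus).
 * `stepCov_two_clauses` — along the tower `n_k = L^k`: the literal two-clause shape with `θ = L⁻²` (`(L^k)⁻² = (L⁻²)^k`), every unit torus `L ∣ M_i`.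
 * `tendsto_stepCov` (`L ≥ 2`) — the tower limit `C^{(∞)}(b,b′)` with tail `C·(L⁻²)^k·e^{−κρ}` and localisation `|C^{(∞)}(b,b′)| ≤ C·e^{−κρ}`
   (`InverseRate.exists_limit_of_step_rate`), and **`tendsto_stepCov_full`** (`L ≥ 1`) — the FULL-SEQUENCE `η = n⁻¹ → 0` limit: `C^{(n+1)}(b,b′) →
   C^{(∞)}(b,b′)` with tail `C·(n+1)⁻²·e^{−κρ}` (the full sequence is Cauchy with modulus `n⁻²`, `cauchySeq_of_le_tendsto_0'`; every tower is a
   subsequence); the limits are NAMED on the fixed finite carrier, not identified with any continuum object (R213-2).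
PRINTED PATTERN, credited: C. King, CMP 102 (1986) Lemma 4.5 (4.38) `|C^{(k)}(x,y) − C^{(k+n)}(x,y)| ≤ CL^{−k}e^{−δ₀|x−y|}` with proof (4.39)–(4.41)
for the U(1)-Higgs unit-lattice covariance with the SOFT constraint `aL⁻²Q*Q` (tree: `King1986/CovarianceRate`); here the same three-line argument
for Bałaban's HARD-constrained (δ(QB)δ_{Ax}) covariance at `U = 1`, whose (4.33) is [B6] (2.153) and whose Lemma 4.3 is NE2's (1.66) strip rate.
PRIOR ART IN THE TREE (credited, not re-derived, not imported): the road-P2 chair's gen-2 END `DirichletExhaustionCoer.convC_balaban` ∕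
`decayCauchy_balaban` (p199806 ✓) — BOTH (CONV-C) clauses for the ℤ^{d+1} TYPING of the same object (`ConvC (covPad (elimZ L) (deltaZ L) (IsFreeZ L)
Λ) … ((L²)⁻¹)`, every `Λ ⊆ ℤ^{d+1}`, `θ = L⁻²`, explicit constants).  THIS FILE is its periodised sibling on pv09's TORUS typing (the currency of
the cell's `U = 1` chain letters, road P2 Parts 3–13, and of this lineage's towers), at the SAME rate `θ = L⁻²`, for EVERY unit torus and ANY two
levels; no junction `deltaZ` ↔ `reDelK` between the two typings is claimed.
HONEST SCOPE.  [folklore] junction of tree theorems BY NAME; `U = 1`; unit tori with `L ∣ M_i`, the unit torus FIXED along the tower (the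
`η = n⁻¹ → 0` direction); constants EXISTENTIAL in (d, L) (the difference constant `C_Δ(d)` is displayed in PART 1).  This is the LINK covariance in
the printed axial parametrisation `B = CB′`; the plaquette ∕ gauge-invariant pairings of ROUTES (t2)(iii) («parametrisation gap»,
`MonotoneTorusCovRate` territory), WHICH of an1's T-rows consume `Γ` (S1 — an2 ∕ gan24-p1's), Bałaban's general-`U` covariance `C^{(k)}(U)` and the
restricted volumes `Λ ⊊ T^{(k)}` are NOT claimed; NOT an instance of the ℤ^{d+1} predicate `ConvC` (carrier = the finite torus `B4.Idx (pbox M)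
(d+1)`).  Nothing printed enters as a hypothesis (ABSOLUTE RULE): 0 def, 0 `def … : Prop`, 0 sorry.  NOT (CONV-C) as typed (Bałaban's `(G_k, H_k,
C^{(k)})` at general `U` in the small-field region with inputs discharged), NEVER «G-an2-4 closed», NOT NE2 ∕ NE3, NOT D1, NOT BetaPertH, NOT
continuum, NOT Clay — not in print as stated here; our bookkeeping.  HONEST DEPENDENCY: continuum YM on T⁴ ⇐ BetaPertH ∧ nine spine
estimates (0/9 proved); BetaPertH ⇐ (D1) ∧ (D4) ∧ CAP+tail; G-an2-4 gates asym, D1 and NE2/3/4.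
-/

noncomputable section

open scoped BigOperators Matrix
open Finset

namespace Summit.QuantumFields.BalabanUV.Beta.GAN24.StepCovarianceTwoClauses

open Filter
open Literature.MathematicalPhysics.QuantumFieldTheory.Balaban1983to89
open B6Lemma24Torus (pbox)
open B4TorusKernel (periodConst)
open B5Symbol166Strip (kappa166 kappa166_pos)
open B6BondEliminationTorus (pdist)
open B6Cov2156Torus (bondReductionT one_le_M gamma2153_pos)
open B6Cov2156TorusDelK (reDelK reDelK_isSymm kernelDecay_reDelK lowerOnConstrainedT_reDelK)
open B5Kernel166Decay (periodConst_pos)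
open T4Rate166StripDirect (C166 C166_pos)
open Summit.QuantumFields.BalabanUV.Beta.GAN24.StepCovarianceInputs (pdist_nonneg sandwichCov_two_levels_of_inputs abs_reDelK_sub_le)
open Summit.QuantumFields.BalabanUV.Beta.GAN24.InverseRate (exists_limit_of_step_rate)

/-! ## §4 Both clauses for Bałaban's step covariances of ANY two levels on EVERY unit torus -/

section StepCovariance

variable {d : ℕ}

/-- **BAŁABAN's STEP COVARIANCES `C^{(n)} = C(C*Δ_nC)⁻¹C*` ([B6] (2.156), the genuine (1.65) `Δ` at fine spacing `n⁻¹`, the explicit axial-gauge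
elimination `C` of p. 250, `U = 1`): BOTH (CONV-C) CLAUSES IN KERNEL CURRENCY FOR ANY TWO LEVELS `1 ≤ n ≤ m` ON EVERY UNIT TORUS** (`d + 1 ≥ 2`,
`L ≥ 1`, period vector `M` with `L ∣ M_i`): there are `κ, C > 0` (functions of `d, L` only) with, for all bond variables `b, b′`:
(i) `|C^{(n)}(b,b′)| ≤ C·e^{−κρ_M(b₋,b′₋)}` and (ii) `|C^{(m)}(b,b′) − C^{(n)}(b,b′)| ≤ C·n⁻²·e^{−κρ_M(b₋,b′₋)}` — KING's RATE, FULL SEQUENCE, EVERY TORUS: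
the torus socket `sandwichCov_two_levels_of_inputs` with its three inputs DISCHARGED for the genuine `Δ_k` by pv09 (`reDelK_isSymm`, `kernelDecay_reDelK`,
(2.153) `lowerOnConstrainedT_reDelK` — the «sliced coercivity», n-FREE) and the difference letter `abs_reDelK_sub_le` (NE2's (1.66) strip rate).
[cite: Balaban1984PropagatorsII, (2.152)–(2.157) pp.249–250; Balaban1984PropagatorsI, (1.65)–(1.66) p.29] [folklore] -/
theorem stepCov_two_levels (hd : 1 ≤ d) (L : ℕ) (hL : 1 ≤ L) :
    ∃ κ C : ℝ, 0 < κ ∧ 0 < C ∧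
      ∀ (M : Fin (d + 1) → ℕ) [∀ μ, NeZero (M μ)], (∀ i, L ∣ M i) →
        ∀ (n m : ℕ) (hn : 1 ≤ n) (hm : 1 ≤ m), n ≤ m → ∀ (p q : B4.Idx (pbox M) (d + 1)),
          |(bondReductionT L M (reDelK n hn M)).cov p q|
              ≤ C * Real.exp (-(κ * pdist M (one_le_M M) (p.1 : Fin (d + 1) → ℤ) (q.1 : Fin (d + 1) → ℤ))) ∧
          |(bondReductionT L M (reDelK m hm M)).cov p q - (bondReductionT L M (reDelK n hn M)).cov p q|
              ≤ C * ((n : ℝ) ^ 2)⁻¹ * Real.exp (-(κ * pdist M (one_le_M M) (p.1 : Fin (d + 1) → ℤ) (q.1 : Fin (d + 1) → ℤ))) := by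
  have hd2 : 2 ≤ d + 1 := by omega
  obtain ⟨c₀, δ₀, hc₀, hδ₀, Hker⟩ := kernelDecay_reDelK (d := d + 1) (by omega)
  set κΔ : ℝ := kappa166 (d + 1) / (d + 1) with hκΔ
  have hκΔ0 : 0 < κΔ := div_pos (kappa166_pos _) (by positivity)
  set CΔ : ℝ := ((d : ℝ) + 1) ^ 2 * (4 * (8 * C166 (d + 1) * periodConst (kappa166 (d + 1)) d)) with hCΔ
  have hCΔ0 : 0 ≤ CΔ := by
    have := C166_pos (d + 1); have := periodConst_pos (kappa166_pos (d + 1)) d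
    positivity
  have hm0 : 0 < min δ₀ κΔ := lt_min hδ₀ hκΔ0
  obtain ⟨c, δ, hc, hδ, H⟩ := sandwichCov_two_levels_of_inputs (d + 1) (L := L) (by omega)
    (gamma2153_pos (d := d + 1) (by omega) hL) hc₀ hm0
  refine ⟨δ, max c (c * CΔ), hδ, lt_max_of_lt_left hc, fun M _ hLM n m hn hm hnm p q => ?_⟩
  have hmono : ∀ {β β' : ℝ} (u v : B4.Idx (pbox M) (d + 1)), β' ≤ β →
      Real.exp (-(β * pdist M (one_le_M M) (u.1 : Fin (d + 1) → ℤ) (v.1 : Fin (d + 1) → ℤ)))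
        ≤ Real.exp (-(β' * pdist M (one_le_M M) (u.1 : Fin (d + 1) → ℤ) (v.1 : Fin (d + 1) → ℤ))) :=
    fun u v hβ => Real.exp_le_exp.mpr (neg_le_neg (mul_le_mul_of_nonneg_right hβ (pdist_nonneg _ _ _)))
  have hker : ∀ (n : ℕ) (hn : 1 ≤ n) (u v : B4.Idx (pbox M) (d + 1)), |reDelK n hn M u v|
        ≤ c₀ * Real.exp (-(min δ₀ κΔ * pdist M (one_le_M M) (u.1 : Fin (d + 1) → ℤ) (v.1 : Fin (d + 1) → ℤ))) :=
    fun n hn u v => (Hker M n hn u v).trans (mul_le_mul_of_nonneg_left (hmono u v (min_le_left _ _)) hc₀.le)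
  have hε : 0 ≤ CΔ * ((n : ℝ) ^ 2)⁻¹ := by positivity
  have hdiff : ∀ u v : B4.Idx (pbox M) (d + 1), |reDelK m hm M u v - reDelK n hn M u v|
        ≤ CΔ * ((n : ℝ) ^ 2)⁻¹ * Real.exp (-(min δ₀ κΔ * pdist M (one_le_M M) (u.1 : Fin (d + 1) → ℤ) (v.1 : Fin (d + 1) → ℤ))) :=
    fun u v => (abs_reDelK_sub_le M hn hm hnm u v).trans (mul_le_mul_of_nonneg_left (hmono u v (min_le_right _ _)) hε)
  obtain ⟨h1, h2⟩ := H M hLM (reDelK n hn M) (reDelK m hm M) (reDelK_isSymm n hn M) (reDelK_isSymm m hm M)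
    (hker n hn) (hker m hm) (lowerOnConstrainedT_reDelK hd2 hL n hn hLM) (lowerOnConstrainedT_reDelK hd2 hL m hm hLM) hε hdiff p q
  have hE := Real.exp_pos (-(δ * pdist M (one_le_M M) (p.1 : Fin (d + 1) → ℤ) (q.1 : Fin (d + 1) → ℤ)))
  refine ⟨h1.trans (mul_le_mul_of_nonneg_right (le_max_left _ _) hE.le), h2.trans ?_⟩
  have e : c * (CΔ * ((n : ℝ) ^ 2)⁻¹) = (c * CΔ) * ((n : ℝ) ^ 2)⁻¹ := by ring
  rw [e]
  exact mul_le_mul_of_nonneg_right (mul_le_mul_of_nonneg_right (le_max_right _ _) (by positivity)) hE.le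

/-- `1 ≤ L^k` for `L ≠ 0` — the level witness used along the tower. [folklore] -/
theorem one_le_pow_of_neZero (L : ℕ) [NeZero L] (k : ℕ) : 1 ≤ L ^ k :=
  Nat.one_le_pow k L (Nat.pos_of_ne_zero (NeZero.ne L))

/-- **ALONG THE TOWER `n_k = L^k`: BOTH CLAUSES WITH `θ = L⁻²`** (every unit torus `L ∣ M_i`, `L ≥ 1`; `(L^k)⁻² = (L⁻²)^k`) — the (CONV-C) two-clause
shape for the unit letter `Γ = C^{(k)}(1)` at King's exponent. [cite: Balaban1984PropagatorsII, (2.156) p.250] [folklore] -/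
theorem stepCov_two_clauses (hd : 1 ≤ d) (L : ℕ) [NeZero L] (hL : 1 ≤ L) :
    ∃ κ C : ℝ, 0 < κ ∧ 0 < C ∧
      ∀ (M : Fin (d + 1) → ℕ) [∀ μ, NeZero (M μ)], (∀ i, L ∣ M i) → ∀ (k : ℕ) (p q : B4.Idx (pbox M) (d + 1)),
        |(bondReductionT L M (reDelK (L ^ k) (one_le_pow_of_neZero L k) M)).cov p q|
            ≤ C * Real.exp (-(κ * pdist M (one_le_M M) (p.1 : Fin (d + 1) → ℤ) (q.1 : Fin (d + 1) → ℤ))) ∧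
        |(bondReductionT L M (reDelK (L ^ (k + 1)) (one_le_pow_of_neZero L (k + 1)) M)).cov p q
            - (bondReductionT L M (reDelK (L ^ k) (one_le_pow_of_neZero L k) M)).cov p q|
            ≤ C * (((L : ℝ) ^ 2)⁻¹) ^ k * Real.exp (-(κ * pdist M (one_le_M M) (p.1 : Fin (d + 1) → ℤ) (q.1 : Fin (d + 1) → ℤ))) := by
  obtain ⟨κ, C, hκ, hC, H⟩ := stepCov_two_levels hd L hL
  refine ⟨κ, C, hκ, hC, fun M _ hLM k p q => ?_⟩
  have h := H M hLM (L ^ k) (L ^ (k + 1)) (one_le_pow_of_neZero L k) (one_le_pow_of_neZero L (k + 1))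
    (Nat.pow_le_pow_right (Nat.pos_of_ne_zero (NeZero.ne L)) (Nat.le_succ k)) p q
  have e : (((L ^ k : ℕ) : ℝ) ^ 2)⁻¹ = (((L : ℝ) ^ 2)⁻¹) ^ k := by
    rw [Nat.cast_pow, ← pow_mul, ← inv_pow, pow_mul', inv_pow]
  rw [e] at h
  exact h

end StepCovariance

/-! ## §5 The tower limit `C^{(∞)}` with tail and localisation -/

section Tower

variable {d : ℕ}

/-- **THE TOWER LIMIT OF BAŁABAN's STEP COVARIANCES IN KERNEL CURRENCY, `U = 1`, EVERY UNIT TORUS `L ∣ M_i`, `L ≥ 2`**: there are `κ, C > 0`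
(functions of `d, L`) such that for every admissible unit torus there is a kernel `C^{(∞)}` on its bond variables with, for all `b, b′`:
`C^{(L^k)}(b,b′) → C^{(∞)}(b,b′)`, `|C^{(L^k)}(b,b′) − C^{(∞)}(b,b′)| ≤ C·(L⁻²)^k·e^{−κρ(b₋,b′₋)}` and `|C^{(∞)}(b,b′)| ≤ C·e^{−κρ(b₋,b′₋)}`
— the limit is NAMED on the fixed finite carrier, not identified with any continuum object.
[cite: Balaban1984PropagatorsII, (2.156) p.250] [folklore] -/
theorem tendsto_stepCov (hd : 1 ≤ d) (L : ℕ) [NeZero L] (hL : 2 ≤ L) :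
    ∃ κ C : ℝ, 0 < κ ∧ 0 < C ∧
      ∀ (M : Fin (d + 1) → ℕ) [∀ μ, NeZero (M μ)], (∀ i, L ∣ M i) →
        ∃ Cinf : Matrix (B4.Idx (pbox M) (d + 1)) (B4.Idx (pbox M) (d + 1)) ℝ, ∀ p q : B4.Idx (pbox M) (d + 1),
          Tendsto (fun k : ℕ => (bondReductionT L M (reDelK (L ^ k) (one_le_pow_of_neZero L k) M)).cov p q) atTop
            (nhds (Cinf p q)) ∧
          (∀ k : ℕ, |(bondReductionT L M (reDelK (L ^ k) (one_le_pow_of_neZero L k) M)).cov p q - Cinf p q|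
            ≤ C * (((L : ℝ) ^ 2)⁻¹) ^ k * Real.exp (-(κ * pdist M (one_le_M M) (p.1 : Fin (d + 1) → ℤ) (q.1 : Fin (d + 1) → ℤ)))) ∧
          |Cinf p q| ≤ C * Real.exp (-(κ * pdist M (one_le_M M) (p.1 : Fin (d + 1) → ℤ) (q.1 : Fin (d + 1) → ℤ))) := by
  have hL1 : 1 ≤ L := le_trans (by norm_num) hL
  obtain ⟨κ, C₀, hκ, hC₀, H⟩ := stepCov_two_clauses hd L hL1
  have hLr : (1 : ℝ) < L := by exact_mod_cast (lt_of_lt_of_le (by norm_num) hL)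
  set θ : ℝ := ((L : ℝ) ^ 2)⁻¹ with hθ
  have hθ1 : θ < 1 := inv_lt_one_of_one_lt₀ (by nlinarith)
  have hθ0 : 0 ≤ θ := by positivity
  have h1θ : 0 < 1 - θ := by linarith
  refine ⟨κ, C₀ + C₀ / (1 - θ), hκ, by positivity, fun M _ hLM => ?_⟩
  have key : ∀ p q : B4.Idx (pbox M) (d + 1), ∃ cpq : ℝ,
      Tendsto (fun k : ℕ => (bondReductionT L M (reDelK (L ^ k) (one_le_pow_of_neZero L k) M)).cov p q) atTop (nhds cpq) ∧
      (∀ k : ℕ, |(bondReductionT L M (reDelK (L ^ k) (one_le_pow_of_neZero L k) M)).cov p q - cpq|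
        ≤ (C₀ + C₀ / (1 - θ)) * θ ^ k * Real.exp (-(κ * pdist M (one_le_M M) (p.1 : Fin (d + 1) → ℤ) (q.1 : Fin (d + 1) → ℤ)))) ∧
      |cpq| ≤ (C₀ + C₀ / (1 - θ)) * Real.exp (-(κ * pdist M (one_le_M M) (p.1 : Fin (d + 1) → ℤ) (q.1 : Fin (d + 1) → ℤ))) := by
    intro p q
    set w : ℝ := Real.exp (-(κ * pdist M (one_le_M M) (p.1 : Fin (d + 1) → ℤ) (q.1 : Fin (d + 1) → ℤ))) with hw
    have hw0 : 0 < w := Real.exp_pos _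
    set F : ℕ → ℝ := fun k => (bondReductionT L M (reDelK (L ^ k) (one_le_pow_of_neZero L k) M)).cov p q with hF
    have hstep : ∀ j : ℕ, ‖F (j + 1) - F j‖ ≤ C₀ * w * θ ^ j := by
      intro j
      rw [Real.norm_eq_abs]
      calc |F (j + 1) - F j| ≤ C₀ * θ ^ j * w := (H M hLM j p q).2
        _ = C₀ * w * θ ^ j := by ring
    obtain ⟨cpq, hlim, htail⟩ := exists_limit_of_step_rate F hθ1 hstep
    have hb0 : |F 0| ≤ C₀ * w := (H M hLM 0 p q).1
    refine ⟨cpq, hlim, fun k => ?_, ?_⟩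
    · have h := htail k
      rw [Real.norm_eq_abs] at h
      have hCk : 0 ≤ C₀ * θ ^ k * w := by positivity
      calc |F k - cpq| ≤ C₀ * w * θ ^ k / (1 - θ) := h
        _ = C₀ / (1 - θ) * θ ^ k * w := by field_simp
        _ ≤ (C₀ + C₀ / (1 - θ)) * θ ^ k * w := by nlinarith
    · have h0 := htail 0
      rw [Real.norm_eq_abs, pow_zero, mul_one] at h0
      have htri : |cpq| ≤ |F 0| + |F 0 - cpq| := by
        have h3 : cpq = F 0 - (F 0 - cpq) := by ring
        calc |cpq| = |F 0 - (F 0 - cpq)| := by rw [← h3]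
          _ ≤ |F 0| + |F 0 - cpq| := abs_sub _ _
      calc |cpq| ≤ |F 0| + |F 0 - cpq| := htri
        _ ≤ C₀ * w + C₀ * w / (1 - θ) := add_le_add hb0 h0
        _ = (C₀ + C₀ / (1 - θ)) * w := by field_simp
  choose cinf hc using key
  exact ⟨Matrix.of fun p q => cinf p q, fun p q => hc p q⟩

/-- **THE FULL-SEQUENCE `η = n⁻¹ → 0` LIMIT OF BAŁABAN's STEP COVARIANCES IN KERNEL CURRENCY, `U = 1`, EVERY UNIT TORUS `L ∣ M_i`, `L ≥ 1`**
(no tower, King's rate): there are `κ, C > 0` (functions of `d, L`) such that for every admissible unit torus there is a kernel `C^{(∞)}` on its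
bond variables with, for all `b, b′` (the sequence indexed by `n + 1`, `n : ℕ`): `C^{(n+1)}(b,b′) → C^{(∞)}(b,b′)` as `n → ∞`,
`|C^{(n+1)}(b,b′) − C^{(∞)}(b,b′)| ≤ C·(n+1)⁻²·e^{−κρ(b₋,b′₋)}` and `|C^{(∞)}(b,b′)| ≤ C·e^{−κρ(b₋,b′₋)}` — `stepCov_two_levels` makes the full
sequence Cauchy with modulus `n⁻²` (`cauchySeq_of_le_tendsto_0'`); every tower `n_k = L′^k` converges to the SAME `C^{(∞)}` (subsequence).
The limit is NAMED on the fixed finite carrier, not identified with any continuum object. [cite: Balaban1984PropagatorsII, (2.156) p.250] [folklore] -/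
theorem tendsto_stepCov_full (hd : 1 ≤ d) (L : ℕ) (hL : 1 ≤ L) :
    ∃ κ C : ℝ, 0 < κ ∧ 0 < C ∧
      ∀ (M : Fin (d + 1) → ℕ) [∀ μ, NeZero (M μ)], (∀ i, L ∣ M i) →
        ∃ Cinf : Matrix (B4.Idx (pbox M) (d + 1)) (B4.Idx (pbox M) (d + 1)) ℝ, ∀ p q : B4.Idx (pbox M) (d + 1),
          Tendsto (fun n : ℕ => (bondReductionT L M (reDelK (n + 1) (Nat.succ_pos n) M)).cov p q) atTop (nhds (Cinf p q)) ∧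
          (∀ n : ℕ, |(bondReductionT L M (reDelK (n + 1) (Nat.succ_pos n) M)).cov p q - Cinf p q|
            ≤ C * (((n : ℝ) + 1) ^ 2)⁻¹ * Real.exp (-(κ * pdist M (one_le_M M) (p.1 : Fin (d + 1) → ℤ) (q.1 : Fin (d + 1) → ℤ)))) ∧
          |Cinf p q| ≤ C * Real.exp (-(κ * pdist M (one_le_M M) (p.1 : Fin (d + 1) → ℤ) (q.1 : Fin (d + 1) → ℤ))) := by
  obtain ⟨κ, C₀, hκ, hC₀, H⟩ := stepCov_two_levels hd L hL
  refine ⟨κ, 2 * C₀, hκ, by positivity, fun M _ hLM => ?_⟩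
  have key : ∀ p q : B4.Idx (pbox M) (d + 1), ∃ cpq : ℝ,
      Tendsto (fun n : ℕ => (bondReductionT L M (reDelK (n + 1) (Nat.succ_pos n) M)).cov p q) atTop (nhds cpq) ∧
      (∀ n : ℕ, |(bondReductionT L M (reDelK (n + 1) (Nat.succ_pos n) M)).cov p q - cpq|
        ≤ 2 * C₀ * (((n : ℝ) + 1) ^ 2)⁻¹ * Real.exp (-(κ * pdist M (one_le_M M) (p.1 : Fin (d + 1) → ℤ) (q.1 : Fin (d + 1) → ℤ)))) ∧
      |cpq| ≤ 2 * C₀ * Real.exp (-(κ * pdist M (one_le_M M) (p.1 : Fin (d + 1) → ℤ) (q.1 : Fin (d + 1) → ℤ))) := by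
    intro p q
    set w : ℝ := Real.exp (-(κ * pdist M (one_le_M M) (p.1 : Fin (d + 1) → ℤ) (q.1 : Fin (d + 1) → ℤ))) with hw
    have hw0 : 0 < w := Real.exp_pos _
    set F : ℕ → ℝ := fun n => (bondReductionT L M (reDelK (n + 1) (Nat.succ_pos n) M)).cov p q with hF
    set b : ℕ → ℝ := fun n => C₀ * (((n : ℝ) + 1) ^ 2)⁻¹ * w with hb
    -- the Cauchy modulus from clause (ii) for any two levels `n + 1 ≤ m + 1`
    have hdist : ∀ n m : ℕ, n ≤ m → dist (F n) (F m) ≤ b n := by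
      intro n m hnm
      rw [dist_comm, Real.dist_eq]
      have h := (H M hLM (n + 1) (m + 1) (Nat.succ_pos n) (Nat.succ_pos m) (by omega) p q).2
      have e : (((n + 1 : ℕ) : ℝ) ^ 2)⁻¹ = (((n : ℝ) + 1) ^ 2)⁻¹ := by push_cast; ring
      rw [e] at h
      exact h
    have hb0 : Tendsto b atTop (nhds 0) := by
      have h1 : Tendsto (fun n : ℕ => (1 / ((n : ℝ) + 1)) ^ 2) atTop (nhds ((0 : ℝ) ^ 2)) :=
        (tendsto_one_div_add_atTop_nhds_zero_nat).pow 2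
      rw [zero_pow two_ne_zero] at h1
      have h2 : Tendsto (fun n : ℕ => C₀ * (1 / ((n : ℝ) + 1)) ^ 2 * w) atTop (nhds (C₀ * 0 * w)) :=
        (tendsto_const_nhds.mul h1).mul tendsto_const_nhds
      rw [mul_zero, zero_mul] at h2
      refine h2.congr' (Filter.Eventually.of_forall fun n => ?_)
      rw [hb]; simp only [one_div, inv_pow]
    obtain ⟨cpq, hlim⟩ := cauchySeq_tendsto_of_complete (cauchySeq_of_le_tendsto_0' b hdist hb0)
    -- the tail: `dist (F n) cpq ≤ b n` by passing to the limit in `m`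
    have htail : ∀ n : ℕ, |F n - cpq| ≤ b n := by
      intro n
      rw [← Real.dist_eq]
      exact le_of_tendsto (tendsto_const_nhds.dist hlim) (Filter.eventually_atTop.2 ⟨n, fun m hm => hdist n m hm⟩)
    have hb1 : ∀ n : ℕ, b n ≤ 2 * C₀ * (((n : ℝ) + 1) ^ 2)⁻¹ * w := fun n => by
      rw [hb]; have : 0 ≤ C₀ * (((n : ℝ) + 1) ^ 2)⁻¹ * w := by positivity
      nlinarith
    have h0 : |F 0| ≤ C₀ * w := (H M hLM 1 1 (Nat.succ_pos 0) (Nat.succ_pos 0) le_rfl p q).1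
    refine ⟨cpq, hlim, fun n => (htail n).trans (hb1 n), ?_⟩
    have ht0 := htail 0
    have e0 : b 0 = C₀ * w := by rw [hb]; norm_num
    rw [e0] at ht0
    have h3 : cpq = F 0 - (F 0 - cpq) := by ring
    calc |cpq| = |F 0 - (F 0 - cpq)| := by rw [← h3]
      _ ≤ |F 0| + |F 0 - cpq| := abs_sub _ _
      _ ≤ C₀ * w + C₀ * w := add_le_add h0 ht0
      _ = 2 * C₀ * w := by ring
  choose cinf hc using key
  exact ⟨Matrix.of fun p q => cinf p q, fun p q => hc p q⟩

end Tower

end Summit.QuantumFields.BalabanUV.Beta.GAN24.StepCovarianceTwoClauses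

end
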